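import Literature.NumberTheory.Rogawski1990.LocalTransferExplicitNonsplit
import Literature.NumberTheory.Rogawski1990.LocalTransferGlueCM
import Literature.NumberTheory.Automorphic.OrbitalMeasureCanonical
import Literature.NumberTheory.Rogawski1990.LocalTransferGlueNhdsOne
import Literature.NumberTheory.Rogawski1990.UnitFundamentalLemmaExplicitNonsplitClosedProof
import Literature.NumberTheory.Automorphic.IntegralMatrixReduction
import Literature.NumberTheory.Rogawski1990.ShalikaGermExpansionNonsplit
import Literature.NumberTheory.Rogawski1990.LocalTransferAtOneOfGermExpansion
import Literature.NumberTheory.Automorphic.OrbitalIntegralReferenceSpan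
import Literature.NumberTheory.Automorphic.GodementHeightFloor
import Literature.NumberTheory.Rogawski1990.UnipotentOrbitalIntegralLevelPiecesCM
import Literature.NumberTheory.Rogawski1990.LocalTransferAtOneHyperspecialLevelTwo
import HarnessLib

/-!
# The local transfer identity at the identity at a HYPERSPECIAL place from the Shalika germ expansion (road «S3-tree», route (A) «SHALIKA»;
# Rogawski 1990 §8.1, Langlands–Shelstad descent §2.1)

Topic `NumberTheory/Rogawski1990`; namespace `Literature.NumberTheory.Rogawski1990`.  THEOREMS ONLY (no definition, no instance, no notation, no named fact, no `sorry`).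
Cell `pub/hodgecm-mathlib` (D-0151), crux H413 = `stmt-HodgeConjecture-24833`, road «S3-tree» (architect A-p16 A-88 (3)∕A-96 (4)∕A-98 (1); chair F0P3a-plan T10-43 (b);
END F0P3a-p03 (g15∕g16)).  HONEST LABEL: HC_CM is proved only modulo the 2 remaining named inputs (hLiu418 24832, h413 24833) until rung 0 closes; this file is
count-neutral support for H413 — it is route (A)'s reduction of the letter `stub_N6nsS3id` AT A HYPERSPECIAL PLACE to the Shalika germ expansion (★ def
`ShalikaGermExpansionNonsplit`, a printed-citation input of the next edition); places outside its scope (ramified, dyadic, bad reduction) are the S3-res letter's.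

THE STATEMENT (`s3id_of_shalika_of_rank_of_le_two`).  At a finite place `v` of `L⁺` unramified and non-split in the CM field `L`, `v ∤ 2`, `H′` hermitian anisotropic
with good reduction at `w ∣ v`, `μ` a unitary Hecke character extending `ω_{L∕L⁺}` unramified at `w`, canonical orbital measure families `mH`, `mG`: IF the unipotent
orbital integrals of `G′_v = U(H′)(L⁺_v)` admit a Shalika germ expansion near `1` (`hShalika : ShalikaGermExpansionNonsplit L H′ v`), THEN every `φ ∈ C_c^∞(G′_v)` has a
local `Δ‴_v`-transfer at the identity: `∃ V ∈ 𝓝 1, ∃ φH ∈ C_c^∞(H_v), Φ^st(γH, φH) = Σ_c Δ‴_v(γH, c)·Φ(c, φ)` for all `G`-regular `γH ∈ V`.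

THE PROOF (fold of ★ organs, 10 lines).  Unpack the germ datum `(S, mU, Γ)` with `hmG.isAdmissibleOn`; ‹RANK› ★ `exists_levelPieces_det_classOrbitalIntegral_ne_zero`
(reference pieces `gref` of hyperspecial level ≤ 2 with invertible unipotent table); ★ `exists_forall_classOrbitalIntegral_eq_sum_mul_of_det_ne_zero` (every `φ` is a
combination of the `gref` on unipotent orbital integrals); the NAMED PARTIAL THEOREM ★ `localTransferAtOne_of_hyperspecialLevel_le_two` at each `gref i`; the germ fold ★
`localTransferAtOne_of_germExpansion` (`det H′ ≠ 0` by ★ `Godement.det_ne_zero_of_anisotropic`).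

## References
* [Rogawski1990] J. D. Rogawski, *Automorphic Representations of Unitary Groups in Three Variables*, Ann. of Math. Stud. 123 (1990): §8.1 Props. 8.1.1–8.1.2
  pp. 112–114; §4.3 (4.3.1) p. 43; §4.9 Prop. 4.9.1 p. 55.
* [LanglandsShelstad1990Descent] R. Langlands, D. Shelstad, *Descent for transfer factors*, The Grothendieck Festschrift II (1990): §2.1 (2.1.2).
* [Shalika1972] J. A. Shalika, *A theorem on semi-simple 𝔭-adic groups*, Ann. of Math. 95 (1972): Thm. 2.1.1.
-/

set_option autoImplicit false

noncomputable section

open NumberField IsDedekindDomain MeasureTheory Measure Topology Filter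
open Literature.NumberTheory.Rogawski1990 Literature.NumberTheory.Automorphic Literature.NumberTheory.GaloisRepresentations
open Literature.NumberTheory.Automorphic.UnitaryGroup Literature.NumberTheory.Automorphic.IntegralReduction
open Literature.AlgebraicGeometry.ShimuraVarieties (unitaryGroup)
open Literature.MeasureTheory.Group (descConj)
open scoped Matrix MatrixGroups Classical ValuativeRel

namespace Literature.NumberTheory.Rogawski1990

/-! ## The theorem -/

/-- **`stub_N6nsS3id` AT A HYPERSPECIAL PLACE from SHALIKA + RANK + the NAMED PARTIAL THEOREM** (route (A) «SHALIKA», next edition «S3id ⟸ SHALIKA + GEN-χ(≤2) + RANK +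
S3-res», T10-42 (3)∕T10-43 (b)): for every `φ ∈ C_c^∞(G′_v)` the local transfer identity at the identity holds near `1 ∈ H_v`, with the letter's `Δ` and canonical families.
Proof: ★ def unpacked with `hmG.isAdmissibleOn`; ★ `exists_levelPieces_det_classOrbitalIntegral_ne_zero`; ★ `exists_forall_classOrbitalIntegral_eq_sum_mul_of_det_ne_zero`;
★ `localTransferAtOne_of_hyperspecialLevel_le_two` at the reference pieces; ★ `localTransferAtOne_of_germExpansion`. [cite: Rogawski1990, §8.1 Prop. 8.1.1 p. 112; §4.3 (4.3.1) p. 43; §4.9 Prop. 4.9.1 p. 55] [cite: LanglandsShelstad1990Descent, §2.1 (2.1.2)] -/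
theorem s3id_of_shalika_of_rank_of_le_two
    (L : Type) [Field L] [NumberField L] [IsCMField L] (H' : Matrix (Fin 3) (Fin 3) L) (μ : HeckeCharacter L)
    {v : HeightOneSpectrum (𝓞 ↥(maximalRealSubfield L))}
    (hH' : (H'.map (cmConjRingHom L)).transpose = H') (w : PlacesOver L v)
    (hw : IsCMField.complexConj L • w.1 = w.1) (hv : Algebra.IsUnramifiedIn (𝓞 L) v.asIdeal)
    (hH'w : IsUnit (placeForm H' w.1)) (hH'i : hH'w.unit ∈ glInt 3 (w.1.adicCompletion L))
    (hμ : μ.IsUnramifiedAt w.1) (hμu : μ.IsUnitary)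
    (hμω : ∀ x : ideleGroup ↥(maximalRealSubfield L), μ (AdeleRing.ideleBaseChange ↥(maximalRealSubfield L) L x) = quadraticHeckeCharCM L x)
    (h2 : IsUnit (2 : 𝒪[w.1.adicCompletion L]))
    [MeasurableSpace ((cmDatum L 3 H').Local v)] [BorelSpace ((cmDatum L 3 H').Local v)]
    [∀ γ : ((cmDatum L 3 H').Local v), MeasurableSpace (((cmDatum L 3 H').Local v) ⧸ Subgroup.centralizer ({γ} : Set ((cmDatum L 3 H').Local v)))]
    [∀ γ : ((cmDatum L 3 H').Local v), BorelSpace (((cmDatum L 3 H').Local v) ⧸ Subgroup.centralizer ({γ} : Set ((cmDatum L 3 H').Local v)))]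
    [MeasurableSpace ((cmDatum L 2 (Matrix.of fun i j : Fin 2 => if i.val + j.val + 1 = 2 then (1 : L) else 0)).Local v × (cmDatum L 1 (Matrix.of fun i j : Fin 1 => if i.val + j.val + 1 = 1 then (1 : L) else 0)).Local v)] [BorelSpace ((cmDatum L 2 (Matrix.of fun i j : Fin 2 => if i.val + j.val + 1 = 2 then (1 : L) else 0)).Local v × (cmDatum L 1 (Matrix.of fun i j : Fin 1 => if i.val + j.val + 1 = 1 then (1 : L) else 0)).Local v)]
  [∀ a : (cmDatum L 2 (Matrix.of fun i j : Fin 2 => if i.val + j.val + 1 = 2 then (1 : L) else 0)).Local v × (cmDatum L 1 (Matrix.of fun i j : Fin 1 => if i.val + j.val + 1 = 1 then (1 : L) else 0)).Local v, MeasurableSpace (((cmDatum L 2 (Matrix.of fun i j : Fin 2 => if i.val + j.val + 1 = 2 then (1 : L) else 0)).Local v × (cmDatum L 1 (Matrix.of fun i j : Fin 1 => if i.val + j.val + 1 = 1 then (1 : L) else 0)).Local v) ⧸ Subgroup.centralizer ({a} : Set ((cmDatum L 2 (Matrix.of fun i j : Fin 2 => if i.val + j.val + 1 = 2 then (1 :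 L) else 0)).Local v × (cmDatum L 1 (Matrix.of fun i j : Fin 1 => if i.val + j.val + 1 = 1 then (1 : L) else 0)).Local v)))]
  [∀ a : (cmDatum L 2 (Matrix.of fun i j : Fin 2 => if i.val + j.val + 1 = 2 then (1 : L) else 0)).Local v × (cmDatum L 1 (Matrix.of fun i j : Fin 1 => if i.val + j.val + 1 = 1 then (1 : L) else 0)).Local v, BorelSpace (((cmDatum L 2 (Matrix.of fun i j : Fin 2 => if i.val + j.val + 1 = 2 then (1 : L) else 0)).Local v × (cmDatum L 1 (Matrix.of fun i j : Fin 1 => if i.val + j.val + 1 = 1 then (1 : L) else 0)).Local v) ⧸ Subgroup.centralizer ({a} : Set ((cmDatum L 2 (Matrix.of fun i j : Fin 2 => if i.val + j.val + 1 = 2 then (1 : L) else 0)).Local v × (cmDatum L 1 (Matrix.of fun i j : Fin 1 => if i.val + j.val + 1 = 1 then (1 : L) else 0)).Local v)))]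
    (νH : Measure ((cmDatum L 2 (Matrix.of fun i j : Fin 2 => if i.val + j.val + 1 = 2 then (1 : L) else 0)).Local v × (cmDatum L 1 (Matrix.of fun i j : Fin 1 => if i.val + j.val + 1 = 1 then (1 : L) else 0)).Local v)) [νH.IsHaarMeasure] [νH.IsMulRightInvariant]
    (νG : Measure ((cmDatum L 3 H').Local v)) [νG.IsHaarMeasure] [νG.IsMulRightInvariant]
    {mH : OrbitalMeasureFamily ((cmDatum L 2 (Matrix.of fun i j : Fin 2 => if i.val + j.val + 1 = 2 then (1 : L) else 0)).Local v × (cmDatum L 1 (Matrix.of fun i j : Fin 1 => if i.val + j.val + 1 = 1 then (1 : L) else 0)).Local v)} {mG : OrbitalMeasureFamily ((cmDatum L 3 H').Local v)}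
    (hmH : mH.IsCanonical (IsLocalGRegular L v) νH)
    (hmG : mG.IsCanonical (fun γ => IsRegularElt (γ.val : GL (Fin 3) (UnitaryGroup.LocalRing L v))) νG)
    -- the letter's anisotropy and ROUTE (A)'s named input at `v`
    (hanis : ∀ x : Fin 3 → L, Literature.AlgebraicGeometry.ShimuraVarieties.hermForm (cmConjRingHom L) H' x x = 0 → x = 0)
    (hShalika : ShalikaGermExpansionNonsplit L H' v) :
    ∀ (φ : ((cmDatum L 3 H').Local v) → ℂ), IsLocSmooth φ →
    ∃ V ∈ 𝓝 (1 : ((cmDatum L 2 (Matrix.of fun i j : Fin 2 => if i.val + j.val + 1 = 2 then (1 : L) else 0)).Local v × (cmDatum L 1 (Matrix.of fun i j : Fin 1 => if i.val + j.val + 1 = 1 then (1 : L) else 0)).Local v)), ∃ φH : ((cmDatum L 2 (Matrix.of fun i j : Fin 2 => if i.val + j.val + 1 = 2 then (1 : L) else 0)).Local v × (cmDatum L 1 (Matrix.of fun i j : Fin 1 => if i.val + j.val + 1 = 1 then (1 : L) else 0)).Local v) → ℂ, IsLocSmooth φH ∧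
        ∀ γH ∈ V, IsLocalGRegular L v γH →
          stableOrbitalIntegralRel (IsLocalStablyConjH L v) mH φH γH =
            ∑ᶠ c : ConjClasses ((cmDatum L 3 H').Local v),
              ((finExplicitCollection L H' μ (finExplicitDelta_conj_left_all L H' μ) (finExplicitDelta_conj_right_all L H' μ)) v).Δ γH (Quotient.out c) *
                classOrbitalIntegral mG φ c := by
  intro φ hφ
  -- ROUTE (A): the germ datum at `v` for the canonical family `mG`
  obtain ⟨S, mU, Γ, hS, hmU, hRao, hgerm⟩ := hShalika mG hmG.isAdmissibleOn
  -- ‹RANK›: reference pieces of hyperspecial level ≤ 2 with an invertible unipotent table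
  obtain ⟨gref, hgs, hgK, hginv, hg2, hdet⟩ := exists_levelPieces_det_classOrbitalIntegral_ne_zero L H' hH' w hw hv hH'w hH'i h2 S hS mU hmU hRao
  -- the germ fold (★ `localTransferAtOne_of_germExpansion`) with `hspan` from ★ p846396 and `htr` from the partial head
  exact localTransferAtOne_of_germExpansion L H' v hH' (Godement.det_ne_zero_of_anisotropic L H' hanis) hmH.isAdmissibleOn
    ((finExplicitCollection L H' μ (finExplicitDelta_conj_left_all L H' μ) (finExplicitDelta_conj_right_all L H' μ)) v) mG S mU Γ hgerm gref hgs
    (fun i => localTransferAtOne_of_hyperspecialLevel_le_two L H' μ hH' w hw hv hH'w hH'i hμ hμu hμω h2 νH νG hmH hmG (gref i) (hgs i) (hgK i) (hginv i) (hg2 i)) φ hφ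
    (exists_forall_classOrbitalIntegral_eq_sum_mul_of_det_ne_zero S mU gref hdet φ)

end Literature.NumberTheory.Rogawski1990

end
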